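import Literature.MathematicalPhysics.StatisticalMechanics.SeparatedShellSums

/-!
# OverbindingBudget · AffineCompressedCut — rider «Tail» (lens-4 g82, head start on (iii) = the 79K energy inequality)

Cell `decomp-a2c`, seat lens-4, generation 82.  ELEMENTARY·PROVED, no new numeric hypothesis, no new `Prop` definitions.

The energy inequality behind the open leaf `…CompressedCutFirst.NearFieldSlackMinSecond 12 (1/25)` (node 79K) compares the near load of an
affinely deep site with the Barlow lattice sum; beyond the radius certified by layer rigidity (`…Frame.layer_rigidity_of_affDeepReg`,
`r₁ = 106/25`) the configuration is only known to be `s`-SEPARATED on annuli (scale coherence along registered first-shell chains,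
`…Chains.chains_exist_record` + `…Scale.affFramed_scale_chain`), and the attractive tail `∑ |p − z|⁻⁶` over such an annulus must be bounded by
volume packing.  The cubic-shell lemma `…CompressedCutFirst.sum_inv_pow_six_le_shell_three` (unit shells, constant `68`) is far too lossy at the
ratios `R/s ≈ 5 … 12` met there (POINTERS-g83 §4c: `0.73` against a margin of `0.47`).  This file supplies the sharp elementary tool:

* ★ `sum_inv_pow_six_le_grid` — ABEL SUMMATION ON A FINE GRID against the SHELL PACKING COUNT
  (`Literature…SeparatedShellSums.card_le_of_separated_of_mem_shell`): for a finite `s`-separated `t ⊂ ℝ³` with all distances from `p` in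
  `[R, R + J·w]` (`s/2 ≤ R`, any grid width `w > 0`, `J ≥ 1` steps),
  `∑_{z ∈ t} |p − z|⁻⁶ ≤ (48/s³)(1 + (w + s/2)/R)³·(w·R⁻⁴ + (R⁻³ − (R + (J−1)w)⁻³)/3) − (8/s³)(R − s/2)³·R⁻⁶ + (8/s³)(R + Jw + s/2)³·(R + Jw)⁻⁶`.
  As `w → 0` this is the disjoint-half-ball integral comparison `∫ (count ≤ volume) d(−r⁻⁶)` with NO overlap loss between shells; e.g. at
  `R/s = 4.74`, `(R + Jw)/s = 6.71` it gives `0.110·s⁻⁶` (one-sided cubic shells: `0.84·s⁻⁶`).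
* `inv_pow_six_sub_le`, `mul_inv_pow_four_le` — the two telescoping inequalities `a⁻⁶ − b⁻⁶ ≤ 6(b − a)a⁻⁷`, `(b − a)b⁻⁴ ≤ (a⁻³ − b⁻³)/3`;
  `telescope_from` — the finite Abel identity `f n = ∑_{j < J} [n ≤ j](f j − f (j+1)) + f J`;
* `sum_inv_pow_six_le_grid_scaled` — the scale-free form (all lengths in units of `ν`, bound `ν⁻⁶ × (…)`), as the 79K bookkeeping (`ν = nn_i`) consumes it.

References: volume packing (folklore); Abel summation.  POINTERS-g83.md §4c (cell decomp-a2c, lens-4 g82) has the numerics this lemma certifies.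
-/

namespace Summit.AtomisticToContinuum.Crystallization.Theorems.OverbindingBudgetAffineCompressedCutTail

open scoped BigOperators Classical
open Literature.MathematicalPhysics.StatisticalMechanics (card_le_of_separated_of_mem_shell)

/-- `a⁻⁶ − b⁻⁶ ≤ 6 (b − a) a⁻⁷` for `0 < a ≤ b` (convexity of `r ↦ r⁻⁶`). -/
theorem inv_pow_six_sub_le {a b : ℝ} (ha : 0 < a) (hab : a ≤ b) :
    a⁻¹ ^ 6 - b⁻¹ ^ 6 ≤ 6 * (b - a) * a⁻¹ ^ 7 := by
  have hb : 0 < b := lt_of_lt_of_le ha hab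
  set x := a⁻¹ with hx_def
  set y := b⁻¹ with hy_def
  have hx : 0 < x := inv_pos.2 ha
  have hy : 0 < y := inv_pos.2 hb
  have hyx : y ≤ x := inv_anti₀ ha hab
  have hxa : x * a = 1 := inv_mul_cancel₀ ha.ne'
  have hyb : y * b = 1 := inv_mul_cancel₀ hb.ne'
  have hxy : x - y = (b - a) * (x * y) := by linear_combination (-x) * hyb + y * hxa
  have hba : 0 ≤ b - a := sub_nonneg.2 hab
  have h1 : x - y ≤ (b - a) * (x * x) :=
    hxy.le.trans (mul_le_mul_of_nonneg_left (mul_le_mul_of_nonneg_left hyx hx.le) hba)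
  have h5 : y ^ 5 ≤ x ^ 5 := pow_le_pow_left₀ hy.le hyx 5
  have h4 : x * y ^ 4 ≤ x * x ^ 4 := mul_le_mul_of_nonneg_left (pow_le_pow_left₀ hy.le hyx 4) hx.le
  have h3 : x ^ 2 * y ^ 3 ≤ x ^ 2 * x ^ 3 := mul_le_mul_of_nonneg_left (pow_le_pow_left₀ hy.le hyx 3) (by positivity)
  have h2 : x ^ 3 * y ^ 2 ≤ x ^ 3 * x ^ 2 := mul_le_mul_of_nonneg_left (pow_le_pow_left₀ hy.le hyx 2) (by positivity)
  have h1' : x ^ 4 * y ≤ x ^ 4 * x := mul_le_mul_of_nonneg_left hyx (by positivity)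
  have hS : x ^ 5 + x ^ 4 * y + x ^ 3 * y ^ 2 + x ^ 2 * y ^ 3 + x * y ^ 4 + y ^ 5 ≤ 6 * x ^ 5 := by nlinarith
  have hS0 : 0 ≤ x ^ 5 + x ^ 4 * y + x ^ 3 * y ^ 2 + x ^ 2 * y ^ 3 + x * y ^ 4 + y ^ 5 := by positivity
  have hfac : x ^ 6 - y ^ 6 = (x - y) * (x ^ 5 + x ^ 4 * y + x ^ 3 * y ^ 2 + x ^ 2 * y ^ 3 + x * y ^ 4 + y ^ 5) := by ring
  calc x ^ 6 - y ^ 6 = (x - y) * (x ^ 5 + x ^ 4 * y + x ^ 3 * y ^ 2 + x ^ 2 * y ^ 3 + x * y ^ 4 + y ^ 5) := hfac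
    _ ≤ ((b - a) * (x * x)) * (6 * x ^ 5) := mul_le_mul h1 hS hS0 (by positivity)
    _ = 6 * (b - a) * x ^ 7 := by ring

/-- `(b − a) b⁻⁴ ≤ (a⁻³ − b⁻³)/3` for `0 < a ≤ b` (the integral test for `r ↦ r⁻⁴`). -/
theorem mul_inv_pow_four_le {a b : ℝ} (ha : 0 < a) (hab : a ≤ b) :
    (b - a) * b⁻¹ ^ 4 ≤ (a⁻¹ ^ 3 - b⁻¹ ^ 3) / 3 := by
  have hb : 0 < b := lt_of_lt_of_le ha hab
  set x := a⁻¹ with hx_def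
  set y := b⁻¹ with hy_def
  have hx : 0 < x := inv_pos.2 ha
  have hy : 0 < y := inv_pos.2 hb
  have hyx : y ≤ x := inv_anti₀ ha hab
  have hxa : x * a = 1 := inv_mul_cancel₀ ha.ne'
  have hyb : y * b = 1 := inv_mul_cancel₀ hb.ne'
  have hxy : x - y = (b - a) * (x * y) := by linear_combination (-x) * hyb + y * hxa
  have hba : 0 ≤ b - a := sub_nonneg.2 hab
  have h1 : (b - a) * (y * y) ≤ x - y :=
    (mul_le_mul_of_nonneg_left (mul_le_mul_of_nonneg_right hyx hy.le) hba).trans hxy.ge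
  have hS : 3 * y ^ 2 ≤ x ^ 2 + x * y + y ^ 2 := by nlinarith [mul_le_mul_of_nonneg_left hyx hy.le, pow_le_pow_left₀ hy.le hyx 2]
  have hfac : x ^ 3 - y ^ 3 = (x - y) * (x ^ 2 + x * y + y ^ 2) := by ring
  have key : (b - a) * (y * y) * (3 * y ^ 2) ≤ (x - y) * (x ^ 2 + x * y + y ^ 2) :=
    mul_le_mul h1 hS (by positivity) (by linarith [hxy, mul_nonneg hba (mul_nonneg hx.le hy.le)])
  rw [hfac.symm] at key
  have : (b - a) * y ^ 4 = (b - a) * (y * y) * (3 * y ^ 2) / 3 := by ring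
  rw [this]
  exact div_le_div_of_nonneg_right key (by norm_num)

/-- Finite ABEL IDENTITY: `f n = ∑_{j < J} [n ≤ j]·(f j − f (j+1)) + f J` for `n ≤ J`. -/
theorem telescope_from (f : ℕ → ℝ) (n : ℕ) :
    ∀ J : ℕ, n ≤ J → f n = (∑ j ∈ Finset.range J, if n ≤ j then f j - f (j + 1) else 0) + f J := by
  intro J
  induction J with
  | zero =>
    intro h
    obtain rfl : n = 0 := Nat.le_zero.1 h
    simp
  | succ J ih =>
    intro h
    rcases h.lt_or_eq with hlt | heq
    · have hnJ : n ≤ J := Nat.lt_succ_iff.1 hlt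
      rw [Finset.sum_range_succ, if_pos hnJ, ih hnJ]
      ring
    · subst heq
      rw [Finset.sum_eq_zero fun j hj => ?_, zero_add]
      rw [Finset.mem_range] at hj
      exact if_neg (by omega)

/-- ★ **TAIL SUM BY ABEL SUMMATION ON A FINE GRID** (see the module docstring): for a finite `s`-separated `t ⊂ ℝ³` whose distances from `p`
all lie in `[R, R + J·w]` (`0 < s`, `s/2 ≤ R`, `0 < w`, `1 ≤ J`),
`∑_{z ∈ t} |p − z|⁻⁶ ≤ (48/s³)(1 + (w + s/2)/R)³ (w R⁻⁴ + (R⁻³ − (R + (J−1)w)⁻³)/3) − (8/s³)(R − s/2)³ R⁻⁶ + (8/s³)(R + Jw + s/2)³ (R + Jw)⁻⁶`.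
[folklore volume packing + Abel summation; this file] -/
theorem sum_inv_pow_six_le_grid (t : Finset (EuclideanSpace ℝ (Fin 3))) (p : EuclideanSpace ℝ (Fin 3))
    {s R w : ℝ} {J : ℕ} (hs : 0 < s) (hR : s / 2 ≤ R) (hw : 0 < w) (hJ : 1 ≤ J)
    (hsep : ∀ z ∈ t, ∀ z' ∈ t, z ≠ z' → s ≤ dist z z')
    (ht : ∀ z ∈ t, R ≤ dist p z ∧ dist p z ≤ R + J * w) :
    ∑ z ∈ t, (dist p z)⁻¹ ^ 6 ≤
      48 / s ^ 3 * (1 + (w + s / 2) / R) ^ 3 * (w * R⁻¹ ^ 4 + (R⁻¹ ^ 3 - (R + (J - 1) * w)⁻¹ ^ 3) / 3)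
        - 8 / s ^ 3 * (R - s / 2) ^ 3 * R⁻¹ ^ 6 + 8 / s ^ 3 * (R + J * w + s / 2) ^ 3 * (R + J * w)⁻¹ ^ 6 := by
  have hRpos : 0 < R := by linarith
  -- the grid `a j = R + j w`, the step `Δ j = a_j⁻⁶ − a_{j+1}⁻⁶`, and the shell index `n z = ⌊(|p − z| − R)/w⌋`
  set a : ℕ → ℝ := fun j => R + j * w with ha_def
  have ha_pos : ∀ j, 0 < a j := fun j => by simp only [ha_def]; positivity
  have ha_mono : ∀ j, a j ≤ a (j + 1) := fun j => by simp only [ha_def]; push_cast; nlinarith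
  have ha_succ : ∀ j, a (j + 1) - a j = w := fun j => by simp only [ha_def]; push_cast; ring
  have ha_ge : ∀ j, R ≤ a j := fun j => by simp only [ha_def]; nlinarith [Nat.cast_nonneg (α := ℝ) j]
  have ha0 : a 0 = R := by simp [ha_def]
  set f : ℕ → ℝ := fun j => (a j)⁻¹ ^ 6 with hf_def
  have hf_anti : ∀ j, f (j + 1) ≤ f j := fun j =>
    pow_le_pow_left₀ (inv_nonneg.2 (ha_pos _).le) (inv_anti₀ (ha_pos j) (ha_mono j)) 6
  set n : EuclideanSpace ℝ (Fin 3) → ℕ := fun z => ⌊(dist p z - R) / w⌋₊ with hn_def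
  have hn_le : ∀ z ∈ t, a (n z) ≤ dist p z := fun z hz => by
    have h0 : 0 ≤ (dist p z - R) / w := div_nonneg (by linarith [(ht z hz).1]) hw.le
    have := Nat.floor_le h0
    rw [le_div_iff₀ hw] at this
    simp only [ha_def]; linarith
  have hn_lt : ∀ z ∈ t, dist p z < a (n z + 1) := fun z hz => by
    have := Nat.lt_floor_add_one ((dist p z - R) / w)
    rw [div_lt_iff₀ hw] at this
    simp only [ha_def]; push_cast; linarith
  have hnJ : ∀ z ∈ t, n z ≤ J := fun z hz => by
    have h1 : ((n z : ℕ) : ℝ) * w ≤ J * w := by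
      have := hn_le z hz; simp only [ha_def] at this; linarith [(ht z hz).2]
    exact_mod_cast le_of_mul_le_mul_right h1 hw
  -- (1) termwise `|p − z|⁻⁶ ≤ f (n z)`, then Abel: `f (n z) = ∑_{j<J} [n z ≤ j] Δ j + f J`
  have step1 : ∑ z ∈ t, (dist p z)⁻¹ ^ 6 ≤ ∑ z ∈ t, f (n z) := by
    refine Finset.sum_le_sum fun z hz => ?_
    exact pow_le_pow_left₀ (inv_nonneg.2 dist_nonneg) (inv_anti₀ (ha_pos _) (hn_le z hz)) 6
  have step2 : ∑ z ∈ t, f (n z) =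
      (∑ j ∈ Finset.range J, (f j - f (j + 1)) * ((t.filter fun z => n z ≤ j).card : ℝ)) + (t.card : ℝ) * f J := by
    have hz : ∀ z ∈ t, f (n z) = (∑ j ∈ Finset.range J, if n z ≤ j then f j - f (j + 1) else 0) + f J :=
      fun z hz => telescope_from f (n z) J (hnJ z hz)
    rw [Finset.sum_congr rfl hz, Finset.sum_add_distrib, Finset.sum_const, nsmul_eq_mul, Finset.sum_comm]
    congr 1
    refine Finset.sum_congr rfl fun j _ => ?_
    rw [← Finset.sum_filter, Finset.sum_const, nsmul_eq_mul, mul_comm]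
  -- (2) shell packing counts: `#{z : n z ≤ j} ≤ (8/s³)((a_{j+1} + s/2)³ − (R − s/2)³)`, `#t ≤ (8/s³)((a_J + s/2)³ − (R − s/2)³)`
  have hcount : ∀ (u : Finset (EuclideanSpace ℝ (Fin 3))) (ρ : ℝ), u ⊆ t → R ≤ ρ →
      (∀ z ∈ u, dist p z ≤ ρ) → (u.card : ℝ) ≤ 8 / s ^ 3 * ((ρ + s / 2) ^ 3 - (R - s / 2) ^ 3) := by
    intro u ρ hu hρ hle
    have h := card_le_of_separated_of_mem_shell u p hs (hRpos.le.trans hρ) hρ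
      (fun c hc => by rw [dist_comm]; exact ⟨(ht c (hu hc)).1, hle c hc⟩)
      (fun c hc d hd hcd => hsep c (hu hc) d (hu hd) hcd)
    rw [finrank_euclideanSpace_fin, max_eq_left (by rw [le_sub_iff_add_le, le_div_iff₀ hs]; linarith)] at h
    have e : (2 * ρ / s + 1) ^ 3 - (2 * R / s - 1) ^ 3 = 8 / s ^ 3 * ((ρ + s / 2) ^ 3 - (R - s / 2) ^ 3) := by
      field_simp; ring
    linarith
  have hC : ∀ j ∈ Finset.range J, ((t.filter fun z => n z ≤ j).card : ℝ) ≤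
      8 / s ^ 3 * ((a (j + 1) + s / 2) ^ 3 - (R - s / 2) ^ 3) := by
    intro j _
    refine hcount _ _ (Finset.filter_subset _ _) (ha_ge _) fun z hz => ?_
    obtain ⟨hzt, hzj⟩ := Finset.mem_filter.1 hz
    have h1 := hn_lt z hzt
    have h2 : a (n z + 1) ≤ a (j + 1) := by
      simp only [ha_def]; push_cast; nlinarith [show ((n z : ℕ) : ℝ) ≤ j by exact_mod_cast hzj]
    linarith
  have hT : (t.card : ℝ) ≤ 8 / s ^ 3 * ((a J + s / 2) ^ 3 - (R - s / 2) ^ 3) :=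
    hcount t (a J) le_rfl (ha_ge J) fun z hz => by simp only [ha_def]; exact (ht z hz).2
  -- (3) per grid step: `Δ j · (a_{j+1} + s/2)³ ≤ 6 w (1 + κ)³ a_j⁻⁴`, `κ = (w + s/2)/R`
  set κ : ℝ := (w + s / 2) / R with hκ_def
  have hκ : 0 ≤ κ := by positivity
  have hΔ : ∀ j, 0 ≤ f j - f (j + 1) := fun j => sub_nonneg.2 (hf_anti j)
  have hstep : ∀ j, (f j - f (j + 1)) * (a (j + 1) + s / 2) ^ 3 ≤ 6 * w * (1 + κ) ^ 3 * (a j)⁻¹ ^ 4 := by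
    intro j
    have h1 : f j - f (j + 1) ≤ 6 * w * (a j)⁻¹ ^ 7 := by
      have := inv_pow_six_sub_le (ha_pos j) (ha_mono j)
      rw [ha_succ] at this
      exact this
    have h2 : a (j + 1) + s / 2 ≤ (1 + κ) * a j := by
      have e1 : a (j + 1) + s / 2 = a j + (w + s / 2) := by linarith [ha_succ j]
      have e2 : w + s / 2 = κ * R := by rw [hκ_def]; field_simp
      have e3 : κ * R ≤ κ * a j := mul_le_mul_of_nonneg_left (ha_ge j) hκ
      nlinarith
    have h3 : (a (j + 1) + s / 2) ^ 3 ≤ ((1 + κ) * a j) ^ 3 :=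
      pow_le_pow_left₀ (by linarith [(ha_pos (j + 1)).le, hs.le]) h2 3
    have h4 : (a j)⁻¹ ^ 7 * (a j) ^ 3 = (a j)⁻¹ ^ 4 := by
      rw [show (7 : ℕ) = 4 + 3 from rfl, pow_add, mul_assoc, ← mul_pow, inv_mul_cancel₀ (ha_pos j).ne', one_pow, mul_one]
    calc (f j - f (j + 1)) * (a (j + 1) + s / 2) ^ 3 ≤ (6 * w * (a j)⁻¹ ^ 7) * ((1 + κ) * a j) ^ 3 :=
          mul_le_mul h1 h3 (by positivity) (by positivity)
      _ = 6 * w * (1 + κ) ^ 3 * ((a j)⁻¹ ^ 7 * (a j) ^ 3) := by ring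
      _ = 6 * w * (1 + κ) ^ 3 * (a j)⁻¹ ^ 4 := by rw [h4]
  -- (4) the grid sum `∑_{j<J} w a_j⁻⁴ ≤ w R⁻⁴ + (R⁻³ − a_{J−1}⁻³)/3` and the telescoping `∑_{j<J} Δ j + f J = R⁻⁶`
  obtain ⟨K, rfl⟩ : ∃ K, J = K + 1 := ⟨J - 1, by omega⟩
  have hgrid : ∑ j ∈ Finset.range (K + 1), w * (a j)⁻¹ ^ 4 ≤ w * R⁻¹ ^ 4 + (R⁻¹ ^ 3 - (a K)⁻¹ ^ 3) / 3 := by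
    rw [Finset.sum_range_succ', ha0]
    have h1 : ∀ j ∈ Finset.range K, w * (a (j + 1))⁻¹ ^ 4 ≤ ((a j)⁻¹ ^ 3 - (a (j + 1))⁻¹ ^ 3) / 3 := by
      intro j _
      have := mul_inv_pow_four_le (ha_pos j) (ha_mono j)
      rwa [ha_succ] at this
    have h2 : ∑ j ∈ Finset.range K, ((a j)⁻¹ ^ 3 - (a (j + 1))⁻¹ ^ 3) / 3 = (R⁻¹ ^ 3 - (a K)⁻¹ ^ 3) / 3 := by
      rw [← Finset.sum_div]
      congr 1
      have := telescope_from (fun j => (a j)⁻¹ ^ 3) 0 K (Nat.zero_le K)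
      simp only [Nat.zero_le, if_true] at this
      rw [ha0] at this
      linarith
    linarith [Finset.sum_le_sum h1]
  have htel : (∑ j ∈ Finset.range (K + 1), (f j - f (j + 1))) + f (K + 1) = R⁻¹ ^ 6 := by
    have := telescope_from f 0 (K + 1) (Nat.zero_le _)
    simp only [Nat.zero_le, if_true] at this
    rw [show f 0 = R⁻¹ ^ 6 by simp [hf_def, ha0]] at this
    exact this.symm
  -- (5) assemble
  have hs3 : 0 < 8 / s ^ 3 := by positivity
  have main : ∑ j ∈ Finset.range (K + 1), (f j - f (j + 1)) * ((t.filter fun z => n z ≤ j).card : ℝ) ≤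
      ∑ j ∈ Finset.range (K + 1),
        (8 / s ^ 3 * (6 * w * (1 + κ) ^ 3 * (a j)⁻¹ ^ 4) - 8 / s ^ 3 * (R - s / 2) ^ 3 * (f j - f (j + 1))) := by
    refine Finset.sum_le_sum fun j hj => ?_
    calc (f j - f (j + 1)) * ((t.filter fun z => n z ≤ j).card : ℝ)
        ≤ (f j - f (j + 1)) * (8 / s ^ 3 * ((a (j + 1) + s / 2) ^ 3 - (R - s / 2) ^ 3)) :=
          mul_le_mul_of_nonneg_left (hC j hj) (hΔ j)
      _ = 8 / s ^ 3 * ((f j - f (j + 1)) * (a (j + 1) + s / 2) ^ 3) - 8 / s ^ 3 * (R - s / 2) ^ 3 * (f j - f (j + 1)) := by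
          ring
      _ ≤ 8 / s ^ 3 * (6 * w * (1 + κ) ^ 3 * (a j)⁻¹ ^ 4) - 8 / s ^ 3 * (R - s / 2) ^ 3 * (f j - f (j + 1)) := by
          linarith [mul_le_mul_of_nonneg_left (hstep j) hs3.le]
  have e : ∑ j ∈ Finset.range (K + 1),
        (8 / s ^ 3 * (6 * w * (1 + κ) ^ 3 * (a j)⁻¹ ^ 4) - 8 / s ^ 3 * (R - s / 2) ^ 3 * (f j - f (j + 1))) =
      8 / s ^ 3 * (6 * (1 + κ) ^ 3 * ∑ j ∈ Finset.range (K + 1), w * (a j)⁻¹ ^ 4)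
        - 8 / s ^ 3 * (R - s / 2) ^ 3 * ∑ j ∈ Finset.range (K + 1), (f j - f (j + 1)) := by
    simp only [Finset.mul_sum]
    rw [← Finset.sum_sub_distrib]
    exact Finset.sum_congr rfl fun j _ => by ring
  have hrem : (t.card : ℝ) * f (K + 1) ≤ 8 / s ^ 3 * ((a (K + 1) + s / 2) ^ 3 - (R - s / 2) ^ 3) * f (K + 1) :=
    mul_le_mul_of_nonneg_right hT (pow_nonneg (inv_nonneg.2 (ha_pos _).le) 6)
  have hK : ((K + 1 : ℕ) : ℝ) - 1 = K := by push_cast; ring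
  have eK : a K = R + (((K + 1 : ℕ) : ℝ) - 1) * w := by rw [hK]
  have eJ : a (K + 1) = R + ((K + 1 : ℕ) : ℝ) * w := rfl
  have efJ : f (K + 1) = (a (K + 1))⁻¹ ^ 6 := rfl
  have h6 : 0 ≤ 6 * (8 / s ^ 3) * (1 + κ) ^ 3 := by positivity
  calc ∑ z ∈ t, (dist p z)⁻¹ ^ 6 ≤ ∑ z ∈ t, f (n z) := step1
    _ = (∑ j ∈ Finset.range (K + 1), (f j - f (j + 1)) * ((t.filter fun z => n z ≤ j).card : ℝ)) +
          (t.card : ℝ) * f (K + 1) := step2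
    _ ≤ (8 / s ^ 3 * (6 * (1 + κ) ^ 3 * ∑ j ∈ Finset.range (K + 1), w * (a j)⁻¹ ^ 4)
          - 8 / s ^ 3 * (R - s / 2) ^ 3 * ∑ j ∈ Finset.range (K + 1), (f j - f (j + 1)))
          + 8 / s ^ 3 * ((a (K + 1) + s / 2) ^ 3 - (R - s / 2) ^ 3) * f (K + 1) := add_le_add (main.trans_eq e) hrem
    _ = 6 * (8 / s ^ 3) * (1 + κ) ^ 3 * (∑ j ∈ Finset.range (K + 1), w * (a j)⁻¹ ^ 4)
          - 8 / s ^ 3 * (R - s / 2) ^ 3 * R⁻¹ ^ 6 + 8 / s ^ 3 * (a (K + 1) + s / 2) ^ 3 * f (K + 1) := by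
        rw [← htel]; ring
    _ ≤ 6 * (8 / s ^ 3) * (1 + κ) ^ 3 * (w * R⁻¹ ^ 4 + (R⁻¹ ^ 3 - (a K)⁻¹ ^ 3) / 3)
          - 8 / s ^ 3 * (R - s / 2) ^ 3 * R⁻¹ ^ 6 + 8 / s ^ 3 * (a (K + 1) + s / 2) ^ 3 * f (K + 1) := by
        have := mul_le_mul_of_nonneg_left hgrid h6
        linarith
    _ = _ := by rw [eK, eJ, efJ]; ring

/-- ★ The SCALE-FREE form of `sum_inv_pow_six_le_grid` (distances in units of `ν > 0`: separation `σν`, shell `[rν, (r + Jω)ν]`, grid `ων`):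
the bound is `ν⁻⁶ ×` the same expression in `(σ, r, ω, J)` — the form the 79K bookkeeping consumes (`ν = nn_i`). -/
theorem sum_inv_pow_six_le_grid_scaled (t : Finset (EuclideanSpace ℝ (Fin 3))) (p : EuclideanSpace ℝ (Fin 3))
    {ν σ r ω : ℝ} {J : ℕ} (hν : 0 < ν) (hσ : 0 < σ) (hr : σ / 2 ≤ r) (hω : 0 < ω) (hJ : 1 ≤ J)
    (hsep : ∀ z ∈ t, ∀ z' ∈ t, z ≠ z' → σ * ν ≤ dist z z')
    (ht : ∀ z ∈ t, r * ν ≤ dist p z ∧ dist p z ≤ (r + J * ω) * ν) :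
    ∑ z ∈ t, (dist p z)⁻¹ ^ 6 ≤
      ν⁻¹ ^ 6 * (48 / σ ^ 3 * (1 + (ω + σ / 2) / r) ^ 3 * (ω * r⁻¹ ^ 4 + (r⁻¹ ^ 3 - (r + (J - 1) * ω)⁻¹ ^ 3) / 3)
        - 8 / σ ^ 3 * (r - σ / 2) ^ 3 * r⁻¹ ^ 6 + 8 / σ ^ 3 * (r + J * ω + σ / 2) ^ 3 * (r + J * ω)⁻¹ ^ 6) := by
  have h := sum_inv_pow_six_le_grid t p (s := σ * ν) (R := r * ν) (w := ω * ν) (J := J) (by positivity)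
    (by nlinarith) (by positivity) hJ hsep
    (fun z hz => ⟨(ht z hz).1, by linarith [(ht z hz).2, show (r + J * ω) * ν = r * ν + J * (ω * ν) by ring]⟩)
  have e1 : (ω * ν + σ * ν / 2) / (r * ν) = (ω + σ / 2) / r := by
    rw [show ω * ν + σ * ν / 2 = (ω + σ / 2) * ν by ring, mul_div_mul_right _ _ hν.ne']
  have e2 : r * ν + ((J : ℝ) - 1) * (ω * ν) = (r + ((J : ℝ) - 1) * ω) * ν := by ring
  have e3 : r * ν + (J : ℝ) * (ω * ν) + σ * ν / 2 = (r + (J : ℝ) * ω + σ / 2) * ν := by ring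
  have e4 : r * ν + (J : ℝ) * (ω * ν) = (r + (J : ℝ) * ω) * ν := by ring
  have e5 : r * ν - σ * ν / 2 = (r - σ / 2) * ν := by ring
  have hrpos : 0 < r := by linarith
  have hr0 : r ≠ 0 := hrpos.ne'
  have hJ0 : r + (J : ℝ) * ω ≠ 0 := by positivity
  have hJ1 : r + ((J : ℝ) - 1) * ω ≠ 0 := by
    have : (1 : ℝ) ≤ J := by exact_mod_cast hJ
    have : 0 ≤ ((J : ℝ) - 1) * ω := mul_nonneg (by linarith) hω.le
    linarith
  rw [e1, e2, e3, e4, e5] at h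
  refine h.trans (le_of_eq ?_)
  field_simp

end Summit.AtomisticToContinuum.Crystallization.Theorems.OverbindingBudgetAffineCompressedCutTail
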